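import Literature.MathematicalPhysics.QuantumManyBody.PeriodicTorusByParts
import HarnessLib

/-!
# Puff's cubic moment, I: the commutator identities `(H - E)(ρ_k Ψ) = A`, `(H - E)A = B`

Topic `Literature/MathematicalPhysics/QuantumManyBody`. Pointwise operator identities behind the
energy-weighted moments of the density response of `N` bosons on the torus `(ℝ³/Lℤ³)^N`
[Puff1965; Stringari1995, §2.3 (20)–(23); Feynman1954]. Let `H = -Δ + V` with the coordinate
Laplacian `Δ = ∑_{i,a} ∂_{i,a}∂_{i,a}` and a real potential `V`, let `u` be a *real* solution of
`-Δu + Vu = Eu` (pointwise), let `k = 2πm/L` be a wave vector of the torus, `eⱼ = e^{ik·xⱼ}`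
(`cellWave L m (X j)`), `∂ⱼ = k·∇_{xⱼ}` (the derivative along `Pi.single j k`), `κ = ‖k‖²`, and
`ρ_k = ∑ⱼ eⱼ` (Feynman's density wave). Then, pointwise,

* `puff_first_commutator` (`u ∈ C²`): `(H - E)(ρ_k u) = A := ∑ⱼ eⱼ (κ u - 2i ∂ⱼu)`
  — the commutator `[H, ρ_k] = ∑ⱼ eⱼ(κ - 2i∂ⱼ)` applied to `u` (f-sum rule numerator);
* `puff_second_commutator` (`u ∈ C³`, `V ∈ C¹`):
  `(H - E)A = B := ∑ⱼ eⱼ (κ² u - 4iκ ∂ⱼu - 4 ∂ⱼ∂ⱼu + 2i (∂ⱼV) u)`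
  — the double commutator `[H, [H, ρ_k]]` applied to `u`, using the equation and its derivative
  `∂ⱼ(Δu) = ∂ⱼ((V - E)u)` (Puff's cubic moment `m₃ = ⟨A, (H-E)A⟩`).

Auxiliary: **Green's identity** `∫ ∑_{i,a} conj(∂_{i,a}η) ∂_{i,a}φ = -∫ conj(η) Δφ` on the torus
(`C¹` periodic `η`, `C²` periodic `φ`) and its consequence for the shifted form
`∫ (∑ Re(conj(∂η)∂φ) + (V - E) Re(conj(η)φ)) = Re ∫ conj(η)(-Δφ + (V - E)φ)`
(`form_pairing_eq_re_integral`); the Laplacian commutes with density-wave derivatives of `C³`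
functions (`laplacian_fderiv_apply_comm`); the Laplacian of a real amplitude viewed in `ℂ`. No integration here
(that is `PuffCubicMomentBlocks.lean`); no definitions; all `[folklore]` calculus except as cited.
-/

noncomputable section

open MeasureTheory
open scoped ENNReal NNReal ComplexConjugate

namespace Literature.MathematicalPhysics.QuantumManyBody.BoseGas

variable {N : ℕ}

/-! ### Real amplitudes: second derivatives and the Laplacian in `ℂ` -/

section RealAmplitude

variable {u : Config N → ℝ}

/-- Second directional derivatives of a real `C²` amplitude viewed in `ℂ` are real. [folklore] -/
theorem fderiv_fderiv_ofReal_apply (hu : ContDiff ℝ 2 u) (X v w : Config N) :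
    fderiv ℝ (fun Y => fderiv ℝ (fun Z => ((u Z : ℝ) : ℂ)) Y v) X w =
      ((fderiv ℝ (fun Y => fderiv ℝ u Y v) X w : ℝ) : ℂ) := by
  have hud := hu.differentiable two_ne_zero
  have h1 : (fun Y => fderiv ℝ (fun Z => ((u Z : ℝ) : ℂ)) Y v) = fun Y => ((fderiv ℝ u Y v : ℝ) : ℂ) :=
    funext fun Y => fderiv_ofReal_apply (hud Y) v
  rw [h1, fderiv_ofReal_apply (differentiable_fderiv_apply_const hu v X)]

/-- The coordinate Laplacian of a real `C²` amplitude viewed in `ℂ` is real. [folklore] -/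
theorem laplacian_ofReal (hu : ContDiff ℝ 2 u) (X : Config N) :
    ∑ i : Fin N, ∑ a : Fin 3, fderiv ℝ (fun Y => fderiv ℝ (fun Z => ((u Z : ℝ) : ℂ)) Y
        (Pi.single i (EuclideanSpace.single a (1 : ℝ)))) X (Pi.single i (EuclideanSpace.single a (1 : ℝ))) =
      ((∑ i : Fin N, ∑ a : Fin 3, fderiv ℝ (fun Y => fderiv ℝ u Y
        (Pi.single i (EuclideanSpace.single a (1 : ℝ)))) X (Pi.single i (EuclideanSpace.single a (1 : ℝ))) :
          ℝ) : ℂ) := by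
  push_cast
  exact Finset.sum_congr rfl fun i _ => Finset.sum_congr rfl fun a _ =>
    fderiv_fderiv_ofReal_apply hu X _ _

/-- **The Laplacian commutes with density-wave derivatives** of a `C³` function:
`Δ(∂_v u) = ∂_v(Δu)` (symmetry of third derivatives). [folklore] -/
theorem laplacian_fderiv_apply_comm (hu : ContDiff ℝ 3 u) (X v : Config N) :
    ∑ i : Fin N, ∑ a : Fin 3, fderiv ℝ (fun Y => fderiv ℝ (fun Z => fderiv ℝ u Z v) Y
        (Pi.single i (EuclideanSpace.single a (1 : ℝ)))) X (Pi.single i (EuclideanSpace.single a (1 : ℝ))) =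
      fderiv ℝ (fun Y => ∑ i : Fin N, ∑ a : Fin 3, fderiv ℝ (fun Z => fderiv ℝ u Z
        (Pi.single i (EuclideanSpace.single a (1 : ℝ)))) Y (Pi.single i (EuclideanSpace.single a (1 : ℝ))))
          X v := by
  have hu2 : ContDiff ℝ 2 u := hu.of_le (by norm_num)
  have hg : ∀ w, ContDiff ℝ 2 (fun Z => fderiv ℝ u Z w) := contDiff_two_fderiv_apply_const hu
  -- the right-hand side, term by term
  have hdiff : ∀ (i : Fin N) (a : Fin 3), DifferentiableAt ℝ (fun Y => fderiv ℝ
      (fun Z => fderiv ℝ u Z (Pi.single i (EuclideanSpace.single a (1 : ℝ)))) Y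
        (Pi.single i (EuclideanSpace.single a (1 : ℝ)))) X :=
    fun i a => differentiable_fderiv_apply_const (hg _) _ X
  rw [fderiv_finset_sum_apply _ fun i _ => ?_]
  · refine Finset.sum_congr rfl fun i _ => ?_
    rw [fderiv_finset_sum_apply _ fun a _ => hdiff i a]
    refine Finset.sum_congr rfl fun a _ => ?_
    set e : Config N := Pi.single i (EuclideanSpace.single a (1 : ℝ)) with he
    -- `∂_e ∂_e ∂_v u = ∂_e ∂_v ∂_e u = ∂_v ∂_e ∂_e u`
    have h1 : (fun Y => fderiv ℝ (fun Z => fderiv ℝ u Z v) Y e) = fun Y => fderiv ℝ (fun Z => fderiv ℝ u Z e) Y v :=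
      funext fun Y => fderiv_fderiv_apply_comm hu2 Y v e
    rw [h1]
    exact fderiv_fderiv_apply_comm (hg e) X v e
  · exact (DifferentiableAt.fun_sum fun a _ => hdiff i a)

end RealAmplitude

/-! ### Green's identity on the torus -/

section Green

variable {L : ℝ}

/-- **Green's identity on the torus** (complex form): for `C¹` periodic `η` and `C²` periodic `φ`,
`∫ ∑_{i,a} conj(∂_{i,a}η) ∂_{i,a}φ = -∫ conj(η) Δφ` with the coordinate Laplacian
`Δφ = ∑_{i,a} ∂_{i,a}∂_{i,a}φ`. [folklore] -/
theorem integral_cellN_sum_conj_fderiv_mul_fderiv (hL : 0 < L) {η φ : Config N → ℂ}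
    (hη : ContDiff ℝ 1 η) (hφ : ContDiff ℝ 2 φ)
    (hηper : ∀ (X : Config N) (i : Fin N) (c : Fin 3),
      η (X + Pi.single i (EuclideanSpace.single c L)) = η X)
    (hφper : ∀ (X : Config N) (i : Fin N) (c : Fin 3),
      φ (X + Pi.single i (EuclideanSpace.single c L)) = φ X) :
    ∫ X in cellN N L, ∑ i : Fin N, ∑ a : Fin 3,
        conj (fderiv ℝ η X (Pi.single i (EuclideanSpace.single a (1 : ℝ)))) *
          fderiv ℝ φ X (Pi.single i (EuclideanSpace.single a (1 : ℝ))) =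
      -∫ X in cellN N L, conj (η X) * ∑ i : Fin N, ∑ a : Fin 3,
        fderiv ℝ (fun Y => fderiv ℝ φ Y (Pi.single i (EuclideanSpace.single a (1 : ℝ)))) X
          (Pi.single i (EuclideanSpace.single a (1 : ℝ))) := by
  have hηc : ContDiff ℝ 1 (fun Y => conj (η Y)) := Complex.conjCLE.contDiff.comp hη
  have hηd := hη.differentiable one_ne_zero
  have hφ1 : ∀ v, ContDiff ℝ 1 (fun Y => fderiv ℝ φ Y v) := contDiff_one_fderiv_apply_const hφ
  set e : Fin N → Fin 3 → Config N := fun i a => Pi.single i (EuclideanSpace.single a (1 : ℝ))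
    with he
  -- termwise
  have hterm : ∀ (i : Fin N) (a : Fin 3),
      ∫ X in cellN N L, conj (fderiv ℝ η X (e i a)) * fderiv ℝ φ X (e i a) =
        -∫ X in cellN N L, conj (η X) * fderiv ℝ (fun Y => fderiv ℝ φ Y (e i a)) X (e i a) := by
    intro i a
    rw [integral_cellN_mul_fderiv_apply hL hηc (hφ1 _)
      (fun X i' c => by simp only [hηper X i' c])
      (fun X i' c => fderiv_apply_periodic hφper _ X i' c) (e i a), neg_neg]
    refine integral_congr_ae (ae_of_all _ fun X => ?_)
    simp only [fderiv_conj_apply (hηd X)]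
  -- sum up
  have hTi : ∀ (i : Fin N) (a : Fin 3), Integrable
      (fun X => conj (fderiv ℝ η X (e i a)) * fderiv ℝ φ X (e i a)) (volume.restrict (cellN N L)) :=
    fun i a => integrableOn_cellN ((Complex.continuous_conj.comp
      (continuous_fderiv_apply_const hη _)).mul
      (continuous_fderiv_apply_const (hφ.of_le (by norm_num)) _)) L
  have hSi : ∀ (i : Fin N) (a : Fin 3), Integrable
      (fun X => conj (η X) * fderiv ℝ (fun Y => fderiv ℝ φ Y (e i a)) X (e i a))
      (volume.restrict (cellN N L)) :=
    fun i a => integrableOn_cellN ((Complex.continuous_conj.comp hη.continuous).mul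
      (continuous_fderiv_apply_const (hφ1 _) _)) L
  simp_rw [Finset.mul_sum]
  calc ∫ X in cellN N L, ∑ i, ∑ a, conj (fderiv ℝ η X (e i a)) * fderiv ℝ φ X (e i a)
      = ∑ i, ∑ a, ∫ X in cellN N L, conj (fderiv ℝ η X (e i a)) * fderiv ℝ φ X (e i a) := by
        rw [integral_finsetSum _ fun i _ => integrable_finsetSum _ fun a _ => hTi i a]
        exact Finset.sum_congr rfl fun i _ => integral_finsetSum _ fun a _ => hTi i a
    _ = ∑ i, ∑ a, -∫ X in cellN N L,
          conj (η X) * fderiv ℝ (fun Y => fderiv ℝ φ Y (e i a)) X (e i a) :=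
        Finset.sum_congr rfl fun i _ => Finset.sum_congr rfl fun a _ => hterm i a
    _ = -∑ i, ∑ a, ∫ X in cellN N L,
          conj (η X) * fderiv ℝ (fun Y => fderiv ℝ φ Y (e i a)) X (e i a) := by
        simp only [Finset.sum_neg_distrib]
    _ = -∫ X in cellN N L, ∑ i, ∑ a,
          conj (η X) * fderiv ℝ (fun Y => fderiv ℝ φ Y (e i a)) X (e i a) := by
        rw [integral_finsetSum _ fun i _ => integrable_finsetSum _ fun a _ => hSi i a]
        congr 1
        exact (Finset.sum_congr rfl fun i _ => integral_finsetSum _ fun a _ => hSi i a).symm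


/-- **The shifted form as a pairing with `(-Δ + W)φ`.** For a continuous real weight `W` (e.g.
`W = V - E₀`), a `C¹` periodic `η` and a `C²` periodic `φ` on the torus:
`∫ (Re ∑_{i,a} conj(∂_{i,a}η)∂_{i,a}φ + W Re(conj(η)φ)) = Re ∫ conj(η)(-Δφ + Wφ)` (Green's identity).
[folklore] -/
theorem form_pairing_eq_re_integral (hL : 0 < L) {W : Config N → ℝ} (hW : Continuous W)
    {η φ : Config N → ℂ} (hη : ContDiff ℝ 1 η) (hφ : ContDiff ℝ 2 φ)
    (hηper : ∀ (X : Config N) (i : Fin N) (c : Fin 3),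
      η (X + Pi.single i (EuclideanSpace.single c L)) = η X)
    (hφper : ∀ (X : Config N) (i : Fin N) (c : Fin 3),
      φ (X + Pi.single i (EuclideanSpace.single c L)) = φ X) :
    ∫ X in cellN N L, ((∑ i : Fin N, ∑ a : Fin 3,
        (conj (fderiv ℝ η X (Pi.single i (EuclideanSpace.single a (1 : ℝ)))) *
          fderiv ℝ φ X (Pi.single i (EuclideanSpace.single a (1 : ℝ)))).re) +
        W X * (conj (η X) * φ X).re) =
      (∫ X in cellN N L, conj (η X) *
        (-(∑ i : Fin N, ∑ a : Fin 3, fderiv ℝ (fun Y => fderiv ℝ φ Y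
            (Pi.single i (EuclideanSpace.single a (1 : ℝ)))) X (Pi.single i (EuclideanSpace.single a (1 : ℝ)))) +
          ((W X : ℝ) : ℂ) * φ X)).re := by
  have hηc := hη.continuous
  have hφc := hφ.continuous
  have hKc : Continuous fun X => ∑ i : Fin N, ∑ a : Fin 3,
      conj (fderiv ℝ η X (Pi.single i (EuclideanSpace.single a (1 : ℝ)))) *
        fderiv ℝ φ X (Pi.single i (EuclideanSpace.single a (1 : ℝ))) := by
    have h1 := hη.continuous_fderiv one_ne_zero
    have h2 := hφ.continuous_fderiv two_ne_zero
    fun_prop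
  have hDc : Continuous fun X => ∑ i : Fin N, ∑ a : Fin 3, fderiv ℝ (fun Y => fderiv ℝ φ Y
      (Pi.single i (EuclideanSpace.single a (1 : ℝ)))) X (Pi.single i (EuclideanSpace.single a (1 : ℝ))) := by
    refine continuous_finsetSum _ fun i _ => continuous_finsetSum _ fun a _ => ?_
    exact continuous_fderiv_apply_const (contDiff_one_fderiv_apply_const hφ _) _
  have hWc : Continuous fun X => ((W X : ℝ) : ℂ) * (conj (η X) * φ X) := by fun_prop
  have hpt : ∀ X, (∑ i : Fin N, ∑ a : Fin 3,
      (conj (fderiv ℝ η X (Pi.single i (EuclideanSpace.single a (1 : ℝ)))) *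
        fderiv ℝ φ X (Pi.single i (EuclideanSpace.single a (1 : ℝ)))).re) + W X * (conj (η X) * φ X).re =
      ((∑ i : Fin N, ∑ a : Fin 3,
        conj (fderiv ℝ η X (Pi.single i (EuclideanSpace.single a (1 : ℝ)))) *
          fderiv ℝ φ X (Pi.single i (EuclideanSpace.single a (1 : ℝ)))) +
        ((W X : ℝ) : ℂ) * (conj (η X) * φ X)).re :=
    fun X => by simp [Complex.mul_re, Complex.re_sum]
  have hint : Integrable (fun X => (∑ i : Fin N, ∑ a : Fin 3,
      conj (fderiv ℝ η X (Pi.single i (EuclideanSpace.single a (1 : ℝ)))) *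
        fderiv ℝ φ X (Pi.single i (EuclideanSpace.single a (1 : ℝ)))) +
      ((W X : ℝ) : ℂ) * (conj (η X) * φ X)) (volume.restrict (cellN N L)) :=
    integrableOn_cellN (hKc.add hWc) L
  refine (integral_congr_ae (ae_of_all _ hpt)).trans ?_
  have h1 := (Complex.reCLM.integral_comp_comm hint).symm
  simp only [Complex.reCLM_apply] at h1
  rw [← h1]
  congr 1
  rw [integral_add (integrableOn_cellN hKc L) (integrableOn_cellN hWc L),
    integral_cellN_sum_conj_fderiv_mul_fderiv hL hη hφ hηper hφper]
  have hi1 : Integrable (fun X => conj (η X) * ∑ i : Fin N, ∑ a : Fin 3, fderiv ℝ (fun Y => fderiv ℝ φ Y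
      (Pi.single i (EuclideanSpace.single a (1 : ℝ)))) X (Pi.single i (EuclideanSpace.single a (1 : ℝ))))
      (volume.restrict (cellN N L)) :=
    integrableOn_cellN ((Complex.continuous_conj.comp hηc).mul hDc) L
  have hi1n : Integrable (fun X => -(conj (η X) * ∑ i : Fin N, ∑ a : Fin 3, fderiv ℝ (fun Y => fderiv ℝ φ Y
      (Pi.single i (EuclideanSpace.single a (1 : ℝ)))) X (Pi.single i (EuclideanSpace.single a (1 : ℝ)))))
      (volume.restrict (cellN N L)) := hi1.neg
  rw [← integral_neg, ← integral_add hi1n (integrableOn_cellN hWc L)]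
  refine integral_congr_ae (ae_of_all _ fun X => ?_)
  ring

end Green

/-! ### The commutator identities -/

/-- Moving the innermost of three sums outside. [folklore] -/
private theorem sum_comm₃ {α β γ M : Type*} [AddCommMonoid M] (s : Finset α) (t : Finset β)
    (u : Finset γ) (f : α → β → γ → M) :
    ∑ a ∈ s, ∑ b ∈ t, ∑ c ∈ u, f a b c = ∑ c ∈ u, ∑ a ∈ s, ∑ b ∈ t, f a b c := by
  calc ∑ a ∈ s, ∑ b ∈ t, ∑ c ∈ u, f a b c
      = ∑ a ∈ s, ∑ c ∈ u, ∑ b ∈ t, f a b c := Finset.sum_congr rfl fun a _ => Finset.sum_comm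
    _ = ∑ c ∈ u, ∑ a ∈ s, ∑ b ∈ t, f a b c := Finset.sum_comm

section Commutators

variable {L : ℝ} (m : Fin 3 → ℤ) {k : Space} {u V : Config N → ℝ} {E : ℝ}

/-- **The first commutator: `(H - E)(ρ_k u) = A`.** For a real `C²` solution `u` of
`-Δu + Vu = Eu` and Feynman's density wave `ρ_k = ∑ⱼ eⱼ` (`k = 2πm/L`, `eⱼ = e^{ik·xⱼ}`):
`-Δ(ρ_k u) + (V - E) ρ_k u = ∑ⱼ eⱼ (‖k‖² u - 2i ∂_{xⱼ·k} u)` pointwise. [cite: Stringari1995, §2.3 (20)] -/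
theorem puff_first_commutator (hk : k = (2 * Real.pi / L) • latticeVec 1 m) (hu : ContDiff ℝ 2 u)
    (hEq : ∀ X : Config N, -(∑ i : Fin N, ∑ a : Fin 3, fderiv ℝ (fun Y => fderiv ℝ u Y
        (Pi.single i (EuclideanSpace.single a (1 : ℝ)))) X (Pi.single i (EuclideanSpace.single a (1 : ℝ)))) +
      V X * u X = E * u X) (X : Config N) :
    -(∑ i : Fin N, ∑ a : Fin 3, fderiv ℝ (fun Y => fderiv ℝ
        (fun Z : Config N => (∑ j : Fin N, cellWave L m (Z j)) * ((u Z : ℝ) : ℂ)) Y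
          (Pi.single i (EuclideanSpace.single a (1 : ℝ)))) X (Pi.single i (EuclideanSpace.single a (1 : ℝ)))) +
      (((V X - E : ℝ) : ℂ)) * ((∑ j : Fin N, cellWave L m (X j)) * ((u X : ℝ) : ℂ)) =
    ∑ j : Fin N, cellWave L m (X j) *
      ((((‖k‖ ^ 2 : ℝ) : ℂ)) * ((u X : ℝ) : ℂ) - 2 * Complex.I * ((fderiv ℝ u X (Pi.single j k) : ℝ) : ℂ)) := by
  have huC : ContDiff ℝ 2 (fun Z : Config N => ((u Z : ℝ) : ℂ)) := contDiff_ofReal_comp hu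
  have hud := hu.differentiable two_ne_zero
  -- distribute the product over the density wave
  have hprod : (fun Z : Config N => (∑ j : Fin N, cellWave L m (Z j)) * ((u Z : ℝ) : ℂ)) =
      fun Z => ∑ j : Fin N, cellWave L m (Z j) * ((u Z : ℝ) : ℂ) :=
    funext fun Z => Finset.sum_mul _ _ _
  rw [hprod]
  -- Laplacian of the sum, term by term
  have hlap : ∀ (i : Fin N) (a : Fin 3), fderiv ℝ (fun Y => fderiv ℝ
      (fun Z : Config N => ∑ j : Fin N, cellWave L m (Z j) * ((u Z : ℝ) : ℂ)) Y
        (Pi.single i (EuclideanSpace.single a (1 : ℝ)))) X (Pi.single i (EuclideanSpace.single a (1 : ℝ))) =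
      ∑ j : Fin N, fderiv ℝ (fun Y => fderiv ℝ (fun Z : Config N => cellWave L m (Z j) * ((u Z : ℝ) : ℂ)) Y
        (Pi.single i (EuclideanSpace.single a (1 : ℝ)))) X (Pi.single i (EuclideanSpace.single a (1 : ℝ))) :=
    fun i a => fderiv_fderiv_finset_sum_apply _
      (fun j _ => (contDiff_cellWave_comp_apply L m j).mul huC) X _ _
  simp_rw [hlap]
  rw [sum_comm₃, Finset.sum_congr rfl fun j _ => laplacian_cellWave_mul L m j hk huC X]
  simp_rw [laplacian_ofReal hu, fderiv_ofReal_apply (hud X)]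
  -- the equation
  rw [Finset.sum_mul, Finset.mul_sum, ← Finset.sum_neg_distrib, ← Finset.sum_add_distrib]
  refine Finset.sum_congr rfl fun j _ => ?_
  have hE' : ((∑ i : Fin N, ∑ a : Fin 3, fderiv ℝ (fun Y => fderiv ℝ u Y
      (Pi.single i (EuclideanSpace.single a (1 : ℝ)))) X (Pi.single i (EuclideanSpace.single a (1 : ℝ))) :
        ℝ) : ℂ) = ((V X - E : ℝ) : ℂ) * ((u X : ℝ) : ℂ) := by
    rw [← Complex.ofReal_mul]
    congr 1
    have h := hEq X
    linarith
  rw [hE']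
  ring

/-- Derivative of the equation: if `Δu = (V - E)u` pointwise with `u ∈ C³`, `V` differentiable,
then `∂_v(Δu) = (∂_vV) u + (V - E) ∂_v u`. [folklore] -/
theorem fderiv_laplacian_of_eq (hu : ContDiff ℝ 3 u) (hV : Differentiable ℝ V)
    (hEq : ∀ X : Config N, -(∑ i : Fin N, ∑ a : Fin 3, fderiv ℝ (fun Y => fderiv ℝ u Y
        (Pi.single i (EuclideanSpace.single a (1 : ℝ)))) X (Pi.single i (EuclideanSpace.single a (1 : ℝ)))) +
      V X * u X = E * u X) (X v : Config N) :
    fderiv ℝ (fun Y => ∑ i : Fin N, ∑ a : Fin 3, fderiv ℝ (fun Z => fderiv ℝ u Z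
        (Pi.single i (EuclideanSpace.single a (1 : ℝ)))) Y (Pi.single i (EuclideanSpace.single a (1 : ℝ))))
          X v =
      fderiv ℝ V X v * u X + (V X - E) * fderiv ℝ u X v := by
  have hud := hu.differentiable (by norm_num)
  have hfun : (fun Y => ∑ i : Fin N, ∑ a : Fin 3, fderiv ℝ (fun Z => fderiv ℝ u Z
      (Pi.single i (EuclideanSpace.single a (1 : ℝ)))) Y (Pi.single i (EuclideanSpace.single a (1 : ℝ)))) =
      fun Y => (V Y - E) * u Y := by
    funext Y
    have h := hEq Y
    linarith
  rw [hfun, fderiv_fun_mul ((hV X).sub_const E) (hud X), fderiv_sub_const]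
  simp only [FunLike.coe_add, FunLike.coe_smul, Pi.add_apply, Pi.smul_apply, smul_eq_mul]
  ring

/-- **The second commutator (Puff): `(H - E)A = B`.** For a real `C³` solution `u` of
`-Δu + Vu = Eu` with `V ∈ C¹`, `k = 2πm/L`, `κ = ‖k‖²`, `∂ⱼ = k·∇_{xⱼ}` and
`A = ∑ⱼ eⱼ(κu - 2i∂ⱼu)`:
`-ΔA + (V - E)A = ∑ⱼ eⱼ (κ²u - 4iκ ∂ⱼu - 4 ∂ⱼ∂ⱼu + 2i (∂ⱼV) u)` pointwise
(`[-Δ, eⱼ] = eⱼ(κ - 2i∂ⱼ)`, `[V, -2i∂ⱼ] = 2i∂ⱼV`, and `(κ - 2i∂ⱼ)` applied to the identically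
vanishing `-Δu + (V-E)u` drops out). [cite: Puff1965, Eq. (11)] -/
theorem puff_second_commutator (hk : k = (2 * Real.pi / L) • latticeVec 1 m) (hu : ContDiff ℝ 3 u)
    (hV : ContDiff ℝ 1 V)
    (hEq : ∀ X : Config N, -(∑ i : Fin N, ∑ a : Fin 3, fderiv ℝ (fun Y => fderiv ℝ u Y
        (Pi.single i (EuclideanSpace.single a (1 : ℝ)))) X (Pi.single i (EuclideanSpace.single a (1 : ℝ)))) +
      V X * u X = E * u X) (X : Config N) :
    -(∑ i : Fin N, ∑ a : Fin 3, fderiv ℝ (fun Y => fderiv ℝ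
        (fun Z : Config N => ∑ j : Fin N, cellWave L m (Z j) *
          ((((‖k‖ ^ 2 : ℝ) : ℂ)) * ((u Z : ℝ) : ℂ) - 2 * Complex.I * ((fderiv ℝ u Z (Pi.single j k) : ℝ) : ℂ))) Y
          (Pi.single i (EuclideanSpace.single a (1 : ℝ)))) X (Pi.single i (EuclideanSpace.single a (1 : ℝ)))) +
      ((V X - E : ℝ) : ℂ) * ∑ j : Fin N, cellWave L m (X j) *
          ((((‖k‖ ^ 2 : ℝ) : ℂ)) * ((u X : ℝ) : ℂ) - 2 * Complex.I * ((fderiv ℝ u X (Pi.single j k) : ℝ) : ℂ)) =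
    ∑ j : Fin N, cellWave L m (X j) *
      ((((‖k‖ ^ 2 : ℝ) : ℂ)) ^ 2 * ((u X : ℝ) : ℂ) -
        4 * Complex.I * ((‖k‖ ^ 2 : ℝ) : ℂ) * ((fderiv ℝ u X (Pi.single j k) : ℝ) : ℂ) -
        4 * ((fderiv ℝ (fun Y => fderiv ℝ u Y (Pi.single j k)) X (Pi.single j k) : ℝ) : ℂ) +
        2 * Complex.I * ((fderiv ℝ V X (Pi.single j k) : ℝ) : ℂ) * ((u X : ℝ) : ℂ)) := by
  have hu2 : ContDiff ℝ 2 u := hu.of_le (by norm_num)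
  have hud := hu2.differentiable two_ne_zero
  have hd2 : ∀ j : Fin N, ContDiff ℝ 2 (fun Z => fderiv ℝ u Z (Pi.single j k)) :=
    fun j => contDiff_two_fderiv_apply_const hu _
  set κ : ℂ := ((‖k‖ ^ 2 : ℝ) : ℂ) with hκ
  -- the modulating amplitudes `w_j = κ u - 2i ∂ⱼu` as linear combinations of real amplitudes
  set w : Fin N → Config N → ℂ := fun j Z =>
    κ * ((u Z : ℝ) : ℂ) + (-2 * Complex.I) * ((fderiv ℝ u Z (Pi.single j k) : ℝ) : ℂ) with hw
  have hwC : ∀ j, ContDiff ℝ 2 (w j) := fun j =>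
    (contDiff_const.mul (contDiff_ofReal_comp hu2)).add (contDiff_const.mul (contDiff_ofReal_comp (hd2 j)))
  have hA : (fun Z : Config N => ∑ j : Fin N, cellWave L m (Z j) *
      (κ * ((u Z : ℝ) : ℂ) - 2 * Complex.I * ((fderiv ℝ u Z (Pi.single j k) : ℝ) : ℂ))) =
      fun Z => ∑ j : Fin N, cellWave L m (Z j) * w j Z := by
    funext Z
    refine Finset.sum_congr rfl fun j _ => ?_
    simp only [hw]
    ring
  rw [hA]
  -- Laplacian term by term
  have hlap : ∀ (i : Fin N) (a : Fin 3), fderiv ℝ (fun Y => fderiv ℝ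
      (fun Z : Config N => ∑ j : Fin N, cellWave L m (Z j) * w j Z) Y
        (Pi.single i (EuclideanSpace.single a (1 : ℝ)))) X (Pi.single i (EuclideanSpace.single a (1 : ℝ))) =
      ∑ j : Fin N, fderiv ℝ (fun Y => fderiv ℝ (fun Z : Config N => cellWave L m (Z j) * w j Z) Y
        (Pi.single i (EuclideanSpace.single a (1 : ℝ)))) X (Pi.single i (EuclideanSpace.single a (1 : ℝ))) :=
    fun i a => fderiv_fderiv_finset_sum_apply _
      (fun j _ => (contDiff_cellWave_comp_apply L m j).mul (hwC j)) X _ _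
  simp_rw [hlap]
  rw [sum_comm₃, Finset.sum_congr rfl fun j _ => laplacian_cellWave_mul L m j hk (hwC j) X]
  -- the pieces: `∂ⱼ w_j`, `Δ w_j`
  have hdw : ∀ j, fderiv ℝ (w j) X (Pi.single j k) =
      κ * ((fderiv ℝ u X (Pi.single j k) : ℝ) : ℂ) +
        (-2 * Complex.I) * ((fderiv ℝ (fun Y => fderiv ℝ u Y (Pi.single j k)) X (Pi.single j k) : ℝ) : ℂ) := by
    intro j
    simp only [hw]
    rw [fderiv_lincomb_apply (differentiableAt_ofReal_comp (hud X))
      (differentiableAt_ofReal_comp ((hd2 j).differentiable two_ne_zero X)),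
      fderiv_ofReal_apply (hud X), fderiv_ofReal_apply ((hd2 j).differentiable two_ne_zero X)]
  have hlapw : ∀ j, ∑ i : Fin N, ∑ a : Fin 3, fderiv ℝ (fun Y => fderiv ℝ (w j) Y
      (Pi.single i (EuclideanSpace.single a (1 : ℝ)))) X (Pi.single i (EuclideanSpace.single a (1 : ℝ))) =
      κ * ((∑ i : Fin N, ∑ a : Fin 3, fderiv ℝ (fun Y => fderiv ℝ u Y
        (Pi.single i (EuclideanSpace.single a (1 : ℝ)))) X (Pi.single i (EuclideanSpace.single a (1 : ℝ))) : ℝ) : ℂ) +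
      (-2 * Complex.I) * ((fderiv ℝ (fun Y => ∑ i : Fin N, ∑ a : Fin 3, fderiv ℝ (fun Z => fderiv ℝ u Z
        (Pi.single i (EuclideanSpace.single a (1 : ℝ)))) Y (Pi.single i (EuclideanSpace.single a (1 : ℝ))))
          X (Pi.single j k) : ℝ) : ℂ) := by
    intro j
    rw [← laplacian_fderiv_apply_comm hu X (Pi.single j k)]
    push_cast
    simp only [Finset.mul_sum, ← Finset.sum_add_distrib]
    refine Finset.sum_congr rfl fun i _ => Finset.sum_congr rfl fun a _ => ?_
    simp only [hw]
    exact fderiv_fderiv_lincomb_ofReal_apply hu2 (hd2 j) κ (-2 * Complex.I) X _ _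
  simp_rw [hdw, hlapw, fderiv_laplacian_of_eq hu (hV.differentiable one_ne_zero) hEq X]
  -- the equation at `X`
  have hE' : ((∑ i : Fin N, ∑ a : Fin 3, fderiv ℝ (fun Y => fderiv ℝ u Y
      (Pi.single i (EuclideanSpace.single a (1 : ℝ)))) X (Pi.single i (EuclideanSpace.single a (1 : ℝ))) :
        ℝ) : ℂ) = ((V X - E : ℝ) : ℂ) * ((u X : ℝ) : ℂ) := by
    rw [← Complex.ofReal_mul]
    congr 1
    have h := hEq X
    linarith
  rw [hE', Finset.mul_sum, ← Finset.sum_neg_distrib, ← Finset.sum_add_distrib]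
  refine Finset.sum_congr rfl fun j _ => ?_
  simp only [hw, hκ]
  push_cast
  have hI : Complex.I ^ 2 = -1 := Complex.I_sq
  linear_combination (4 * cellWave L m (X j) *
    ((fderiv ℝ (fun Y => fderiv ℝ u Y (Pi.single j k)) X (Pi.single j k) : ℝ) : ℂ)) * hI

end Commutators

end Literature.MathematicalPhysics.QuantumManyBody.BoseGas

end
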